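import Mathlib.Analysis.SpecialFunctions.JapaneseBracket
import Literature.NumberTheory.LFunctions.RieszMeanPerron
import Literature.NumberTheory.LFunctions.DedekindZetaLogDerivGRH
import Literature.Analysis.Complex.CahenMellinDirichlet
import HarnessLib

/-!
# A Chebyshev lower bound for `ψ_K` under GRH, uniform in the number field

Topic `Literature/NumberTheory/LFunctions` (namespace `Literature.NumberTheory.LFunctions`).
Everything in this file is PROVED; there are no named facts. The only hypothesis is the Extended
Riemann Hypothesis for the field `K` (`NumberField.ExtendedRiemannHypothesis K`).

**Theorem** (`chebyshevPsiIdeal_ge_of_erh`). There is an absolute, explicit constant `C`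
(`grhPsiConst`) such that for every number field `K` whose Dedekind zeta function satisfies the
Riemann hypothesis and every real `x ≥ 2`,

  `ψ_K(x) ≥ x/2 − C √x · log x · (log|d_K| + n_K)`,

`ψ_K(x) = ∑_{N𝔭^m ≤ x} log N𝔭` (`chebyshevPsiIdeal`), `d_K` the discriminant, `n_K = [K : ℚ]`.

This is a one-sided, weak-constant form of the GRH-conditional prime ideal theorem of
Lagarias–Odlyzko 1977 (Thm. 1.1: `ψ_K(x) = x + O(√x log x (log d_K + n_K log x))`), sufficient for
density lower bounds (Bürgisser 2000 TCS, Thm. 4.1, via `GRHDegreeOnePrimesLowerBound.lean`), and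
provable without the truncated explicit formula: it loses the factor `2` of the main term to a
smoothing.

**Proof.** Perron's formula of order one (Riesz mean; `rieszMean_eq_integral_LSeries`, the
generic form of the tree's `rieszMean_vonMangoldt_eq_integral_LSeries`):
`∑_{n ≤ x} Λ_K(n)(x − n) = (1/2πi) ∫_{(2)} F`, `F(s) = (−ζ_K'/ζ_K)(s) x^{s+1}/(s(s+1))`, the
integral converging absolutely. We write `−ζ_K'/ζ_K = 1/(s−1) − ζ₁'/ζ₁` with the entire
`ζ₁ = (s−1)ζ_K` (`dedekindZeta₁`), so that `F` is meromorphic on `Re s > 1/2` under ERH with a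
single simple pole at `s = 1`, residue `x²/2`. The residue theorem for the strip
`1/2 + η ≤ Re s ≤ 2`, `η = 1/log x` (`Literature.Analysis.Complex.integral_vertical_sub_eq_sum_of_simplePoles`)
moves the line to `Re s = 1/2 + η`, where `|ζ₁'/ζ₁| ≤ 3024 M_K(t)/η`
(`norm_logDeriv_dedekindZeta₁_le_of_erh'`, `M_K(t) = log|d_K| + 3n_K + (n_K+1) log(|t|+7)`) and
`|x^{s+1}| = e x^{3/2}`; the kernel `1/(s(s+1))` is `O(1/(1/4 + t²))` and
`∫ log(|t| + 7) dt/(1/4 + t²) < ∞`, giving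
`∑_{n ≤ x} Λ_K(n)(x − n) ≥ x²/2 − C x^{3/2} log x (log|d_K| + n_K)`; finally
`x ψ_K(x) ≥ ∑_{n ≤ x} Λ_K(n)(x − n)`.

## References

* J. C. Lagarias, A. M. Odlyzko, *Effective versions of the Chebotarev density theorem* (1977),
  Thm. 1.1 and §§5–7 (`LagariasOdlyzko1977`).
* A. E. Ingham, *The Distribution of Prime Numbers* (1932), Ch. II §5 Thm. B, Ch. IV §4 (Riesz
  means).
* H. L. Montgomery, R. C. Vaughan, *Multiplicative Number Theory I* (2007), §5.1 (5.19)–(5.20).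
-/

noncomputable section

open Complex Filter Topology Set Metric MeasureTheory NumberField
open scoped NumberField

namespace Literature.NumberTheory.LFunctions

/-! ### Perron's formula of order one for a Dirichlet series with real coefficients -/

section Riesz

variable (a : ℕ → ℝ)

/-- One term: for `x > 0`, `σ > 0`, `n ≥ 1`,
`a(n) (x − n)⁺ = (1/2π) ∫ x^{1+σ+it} a(n) n^{−(σ+it)} dt/((σ+it)(σ+1+it))` (the Perron kernel of
order one, `mellinInv_kernel_eq`). [folklore] -/
theorem mul_posPart_eq_integral {x : ℝ} (hx : 0 < x) {σ : ℝ} (hσ : 0 < σ) {n : ℕ} (hn : n ≠ 0) :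
    (((a n : ℝ) * max (x - n) 0 : ℝ) : ℂ) =
      (1 / (2 * Real.pi) : ℂ) * ∫ t : ℝ, (x : ℂ) ^ (1 + (σ + t * I)) *
        LSeries.term (fun n ↦ (a n : ℂ)) (σ + t * I) n *
          (1 / ((σ + t * I) * (σ + t * I + 1))) := by
  have hn0 : (0 : ℝ) < n := Nat.cast_pos.2 (Nat.pos_of_ne_zero hn)
  have hy : 0 < (n : ℝ) / x := div_pos hn0 hx
  have hK := mellinInv_kernel_eq hσ hy
  unfold mellinInv at hK
  have hmax : (x : ℝ) * max (1 - n / x) 0 = max (x - n) 0 := by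
    rw [mul_max_of_nonneg _ _ hx.le, mul_sub, mul_one, mul_div_cancel₀ _ hx.ne', mul_zero]
  have hlhs : (((a n : ℝ) * max (x - n) 0 : ℝ) : ℂ) =
      ((a n : ℝ) : ℂ) * (x : ℂ) * ((max (1 - (n : ℝ) / x) 0 : ℝ) : ℂ) := by
    rw [← hmax]; push_cast; ring
  rw [hlhs, ← hK, Complex.real_smul]
  have hx0 : (x : ℂ) ≠ 0 := ofReal_ne_zero.2 hx.ne'
  have hnC : (n : ℂ) ≠ 0 := Nat.cast_ne_zero.2 hn
  have hpt : ∀ t : ℝ, ((a n : ℝ) : ℂ) * (x : ℂ) *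
      (((n : ℂ) / (x : ℂ)) ^ (-((σ : ℂ) + t * I)) • (1 / (((σ : ℂ) + t * I) * ((σ : ℂ) + t * I + 1)))) =
      (x : ℂ) ^ (1 + (σ + t * I)) * LSeries.term (fun n ↦ (a n : ℂ)) (σ + t * I) n *
        (1 / ((σ + t * I) * (σ + t * I + 1))) := by
    intro t
    set s : ℂ := σ + t * I with hs
    simp only [smul_eq_mul]
    have hpow : ((n : ℂ) / (x : ℂ)) ^ (-s) = (x : ℂ) ^ s / (n : ℂ) ^ s := by
      rw [show (n : ℂ) / (x : ℂ) = (((n : ℝ) * x⁻¹ : ℝ) : ℂ) by push_cast; ring, cpow_neg,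
        ofReal_mul, mul_cpow_ofReal_nonneg hn0.le (inv_nonneg.2 hx.le), ofReal_inv,
        inv_cpow _ _ ?_, mul_inv, inv_inv]
      · simp only [ofReal_natCast]; ring
      · rw [arg_ofReal_of_nonneg hx.le]; exact Real.pi_pos.ne
    rw [hpow, LSeries.term_of_ne_zero hn]
    conv_rhs => rw [cpow_add _ _ hx0, cpow_one]
    field_simp
  calc ((a n : ℝ) : ℂ) * (x : ℂ) * ((((1 / (2 * Real.pi) : ℝ)) : ℂ) *
        ∫ t : ℝ, (((n : ℝ) / x : ℝ) : ℂ) ^ (-((σ : ℂ) + t * I)) •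
          (fun s : ℂ ↦ 1 / (s * (s + 1))) ((σ : ℂ) + t * I))
      = (((1 / (2 * Real.pi) : ℝ)) : ℂ) * ∫ t : ℝ, ((a n : ℝ) : ℂ) * (x : ℂ) *
          ((((n : ℝ) / x : ℝ) : ℂ) ^ (-((σ : ℂ) + t * I)) •
            (fun s : ℂ ↦ 1 / (s * (s + 1))) ((σ : ℂ) + t * I)) := by
        rw [integral_const_mul]; ring
    _ = _ := by
        push_cast
        congr 1
        exact integral_congr_ae (Eventually.of_forall hpt)

/-- **Perron's formula of order one (Riesz mean) for a Dirichlet series with real coefficients**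
(Ingham Ch. IV §4 (17), kernel of Ch. II §5 Thm. B with `k = 1`; Montgomery–Vaughan (5.20)):
if `a(0) = 0` and `∑ a(n) n^{-σ}` converges absolutely (`σ > 0`), then for `x > 0`
`∑_{n ≤ x} a(n)(x − n) = (1/2π) ∫_{−∞}^{∞} x^{1+s} L(a, s)/(s(s+1)) dt`, `s = σ + it`, the integral
converging absolutely. (The tree's `rieszMean_vonMangoldt_eq_integral_LSeries` is the case
`a = Λ`.) [cite: MontgomeryVaughan2007, §5.1 (5.19)–(5.20)] -/
theorem rieszMean_eq_integral_LSeries (ha0 : a 0 = 0) {x : ℝ} (hx : 0 < x) {σ : ℝ} (hσ : 0 < σ)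
    (hsum : LSeriesSummable (fun n ↦ (a n : ℂ)) σ) :
    ((∑ n ∈ Finset.Ioc 0 ⌊x⌋₊, (a n : ℝ) * (x - n) : ℝ) : ℂ) =
      (1 / (2 * Real.pi) : ℂ) * ∫ t : ℝ, (x : ℂ) ^ (1 + (σ + t * I)) *
        LSeries (fun n ↦ (a n : ℂ)) (σ + t * I) * (1 / ((σ + t * I) * (σ + t * I + 1))) := by
  have hx0 : (x : ℂ) ≠ 0 := ofReal_ne_zero.2 hx.ne'
  set Kf : ℝ → ℂ := fun t ↦ 1 / (((σ : ℂ) + t * I) * ((σ : ℂ) + t * I + 1)) with hKf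
  set G : ℕ → ℝ → ℂ := fun n t ↦ (x : ℂ) ^ (1 + (σ + t * I)) *
    LSeries.term (fun n ↦ (a n : ℂ)) (σ + t * I) n with hG
  set F : ℕ → ℝ → ℂ := fun n t ↦ G n t * Kf t with hF
  have hnormG : ∀ n t, ‖G n t‖ = x ^ (1 + σ) * ‖LSeries.term (fun n ↦ (a n : ℂ)) σ n‖ := by
    intro n t
    simp only [hG, norm_mul]
    congr 1
    · rw [norm_cpow_eq_rpow_re_of_pos hx]; simp
    · rcases eq_or_ne n 0 with rfl | hn
      · simp [LSeries.term_zero]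
      · rw [LSeries.norm_term_eq, LSeries.norm_term_eq]
        simp [hn]
  have hcontG : ∀ n, Continuous (G n) := by
    intro n
    simp only [hG]
    refine Continuous.mul ?_ ?_
    · refine continuous_iff_continuousAt.2 fun t ↦ ?_
      exact (continuousAt_const_cpow hx0).comp (f := fun t : ℝ ↦ 1 + ((σ : ℂ) + t * I))
        (by fun_prop)
    · rcases eq_or_ne n 0 with rfl | hn
      · simp only [LSeries.term_zero]; exact continuous_const
      · simp only [LSeries.term_of_ne_zero hn]
        refine continuous_const.div ?_ fun t ↦ ?_
        · refine continuous_iff_continuousAt.2 fun t ↦ ?_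
          exact (continuousAt_const_cpow (Nat.cast_ne_zero.2 hn)).comp
            (f := fun t : ℝ ↦ ((σ : ℂ) + t * I)) (by fun_prop)
        · exact cpow_ne_zero_iff.2 (Or.inl (Nat.cast_ne_zero.2 hn))
  have hintK : Integrable Kf := integrable_kernel hσ
  have hintF : ∀ n, Integrable (F n) := fun n ↦
    hintK.bdd_mul (hcontG n).aestronglyMeasurable (Eventually.of_forall fun t ↦ (hnormG n t).le)
  have hsumF : Summable fun n ↦ ∫ t, ‖F n t‖ := by
    have hS : Summable fun n ↦ ‖LSeries.term (fun n ↦ (a n : ℂ)) σ n‖ := hsum.norm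
    have := (hS.mul_left (x ^ (1 + σ))).mul_right (∫ t : ℝ, ‖Kf t‖)
    refine this.congr fun n ↦ ?_
    rw [← integral_const_mul]
    refine integral_congr_ae (Eventually.of_forall fun t ↦ ?_)
    simp only [hF, norm_mul, hnormG n t]
  have hterm : ∀ n : ℕ, (((a n : ℝ) * max (x - n) 0 : ℝ) : ℂ) =
      (1 / (2 * Real.pi) : ℂ) * ∫ t, F n t := by
    intro n
    rcases eq_or_ne n 0 with rfl | hn
    · simp [hF, hG, LSeries.term_zero, ha0]
    · exact mul_posPart_eq_integral a hx hσ hn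
  have hlhs : ((∑ n ∈ Finset.Ioc 0 ⌊x⌋₊, (a n : ℝ) * (x - n) : ℝ) : ℂ) =
      ∑' n : ℕ, (((a n : ℝ) * max (x - n) 0 : ℝ) : ℂ) := by
    have h0 : (0 : ℕ) ∉ Finset.Ioc 0 ⌊x⌋₊ := by simp
    rw [tsum_eq_sum (s := insert 0 (Finset.Ioc 0 ⌊x⌋₊)), Finset.sum_insert h0]
    · simp only [Nat.cast_zero, ha0, zero_mul, ofReal_zero, zero_add]
      push_cast
      refine Finset.sum_congr rfl fun n hn ↦ ?_
      rw [Finset.mem_Ioc] at hn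
      have hnx : (n : ℝ) ≤ x := (Nat.cast_le.2 hn.2).trans (Nat.floor_le hx.le)
      rw [max_eq_left (by linarith)]
      push_cast; ring
    · intro n hn
      rw [Finset.mem_insert, not_or, Finset.mem_Ioc, not_and_or, not_lt, not_le] at hn
      obtain ⟨hn0, hn'⟩ := hn
      have hn1 : ⌊x⌋₊ < n := by
        rcases hn' with h | h
        · exact absurd h (not_le.2 (Nat.pos_of_ne_zero hn0))
        · exact h
      have hxn : x < n := by
        have := Nat.lt_of_floor_lt hn1
        exact_mod_cast this
      rw [max_eq_right (by linarith)]
      simp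
  rw [hlhs, tsum_congr hterm, tsum_mul_left, integral_tsum_of_summable_integral_norm hintF hsumF]
  congr 1
  refine integral_congr_ae (Eventually.of_forall fun t ↦ ?_)
  simp only [hF, hG, hKf]
  rw [LSeries, ← tsum_mul_left, ← tsum_mul_right]

/-- The Riesz mean of a non-negative sequence is at most `x` times its summatory function:
`∑_{n ≤ x} a(n)(x − n) ≤ x ∑_{n ≤ x} a(n)`. [folklore] -/
theorem rieszMean_le_mul_sum (ha : ∀ n, 0 ≤ a n) {x : ℝ} (hx : 0 ≤ x) :
    ∑ n ∈ Finset.Ioc 0 ⌊x⌋₊, a n * (x - n) ≤ x * ∑ n ∈ Finset.Icc 0 ⌊x⌋₊, a n := by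
  have hsub : Finset.Ioc 0 ⌊x⌋₊ ⊆ Finset.Icc 0 ⌊x⌋₊ := fun n hn ↦ by
    rw [Finset.mem_Ioc] at hn; rw [Finset.mem_Icc]; omega
  calc ∑ n ∈ Finset.Ioc 0 ⌊x⌋₊, a n * (x - n) ≤ ∑ n ∈ Finset.Ioc 0 ⌊x⌋₊, x * a n := by
        refine Finset.sum_le_sum fun n _ ↦ ?_
        rw [mul_comm]
        exact mul_le_mul_of_nonneg_right (by linarith [Nat.cast_nonneg (α := ℝ) n]) (ha n)
    _ ≤ ∑ n ∈ Finset.Icc 0 ⌊x⌋₊, x * a n :=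
        Finset.sum_le_sum_of_subset_of_nonneg hsub fun n _ _ ↦ mul_nonneg hx (ha n)
    _ = x * ∑ n ∈ Finset.Icc 0 ⌊x⌋₊, a n := (Finset.mul_sum _ _ _).symm

end Riesz

/-! ### An absolutely convergent weight: `∫ log(|t| + 7) dt/(1/4 + t²) < ∞` -/

/-- `log(|t| + 7) ≤ 4 √(1 + |t|)` (`log(1 + u) ≤ 2√u`, `log 7 ≤ 2`). [folklore] -/
theorem log_abs_add_seven_le (t : ℝ) : Real.log (|t| + 7) ≤ 4 * Real.sqrt (1 + |t|) := by
  have ht : 0 ≤ |t| := abs_nonneg t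
  have h7 : Real.log 7 ≤ 2 := by
    rw [← Real.log_exp 2]
    refine Real.log_le_log (by norm_num) ?_
    have := Real.exp_one_gt_d9
    have h2 : Real.exp 2 = Real.exp 1 * Real.exp 1 := by rw [← Real.exp_add]; norm_num
    nlinarith
  have hsplit : Real.log (|t| + 7) = Real.log 7 + Real.log (1 + |t| / 7) := by
    rw [← Real.log_mul (by norm_num) (by positivity)]; congr 1; ring
  have hlog1 : Real.log (1 + |t| / 7) ≤ Real.log (1 + |t|) :=
    Real.log_le_log (by positivity) (by linarith)
  -- `log(1 + u) ≤ 2 (√(1+u) − 1) ≤ 2 √(1+u) − 2`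
  have hs1 : 1 ≤ Real.sqrt (1 + |t|) := (Real.le_sqrt zero_le_one (by positivity)).mpr (by nlinarith)
  have hlog2 : Real.log (1 + |t|) ≤ 2 * (Real.sqrt (1 + |t|) - 1) := by
    have hpos : 0 < Real.sqrt (1 + |t|) := by linarith
    have h := Real.log_le_sub_one_of_pos hpos
    rw [Real.log_sqrt (by positivity)] at h
    linarith
  linarith

/-- `t ↦ log(|t| + 7)/(1/4 + t²)` is integrable on `ℝ` (dominated by `32 (1 + |t|)^{-3/2}`,
Mathlib's `integrable_one_add_norm`). [folklore] -/
theorem integrable_log_div_sq : Integrable fun t : ℝ ↦ Real.log (|t| + 7) / (1 / 4 + t ^ 2) := by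
  have h32 : Integrable fun t : ℝ ↦ 32 * (1 + ‖t‖) ^ (-(3 / 2 : ℝ)) :=
    (integrable_one_add_norm (E := ℝ) (μ := volume) (r := 3 / 2)
      (by rw [Module.finrank_self]; norm_num)).const_mul 32
  refine h32.mono' ?_ (Eventually.of_forall fun t ↦ ?_)
  · refine Continuous.aestronglyMeasurable ?_
    refine Continuous.div ?_ (by fun_prop) fun t ↦ by positivity
    exact (continuous_abs.add continuous_const).log fun t ↦ (by positivity : (0 : ℝ) < |t| + 7).ne'
  · have hu : 0 ≤ |t| := abs_nonneg t
    set v : ℝ := 1 + |t| with hv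
    have hv0 : 0 < v := by rw [hv]; linarith
    have hden : 0 < 1 / 4 + t ^ 2 := by positivity
    rw [Real.norm_eq_abs, abs_of_nonneg (div_nonneg (zero_le_one.trans (one_le_log_abs_add_seven t))
      hden.le), Real.norm_eq_abs]
    have h1 : Real.log (|t| + 7) / (1 / 4 + t ^ 2) ≤ 4 * Real.sqrt v / (1 / 4 + t ^ 2) :=
      div_le_div_of_nonneg_right (log_abs_add_seven_le t) hden.le
    refine h1.trans ?_
    rw [Real.rpow_neg hv0.le, ← div_eq_mul_inv, div_le_div_iff₀ hden (Real.rpow_pos_of_pos hv0 _)]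
    have hkey : Real.sqrt v * v ^ (3 / 2 : ℝ) = v ^ 2 := by
      rw [Real.sqrt_eq_rpow, ← Real.rpow_add hv0]
      norm_num
    have ht2 : t ^ 2 = |t| ^ 2 := (sq_abs t).symm
    calc 4 * Real.sqrt v * v ^ (3 / 2 : ℝ) = 4 * (Real.sqrt v * v ^ (3 / 2 : ℝ)) := by ring
      _ = 4 * v ^ 2 := by rw [hkey]
      _ ≤ 32 * (1 / 4 + t ^ 2) := by rw [ht2, hv]; nlinarith

/-! ### The Perron integrand `F_{K,x}(s) = (−ζ_K'/ζ_K)(s) x^{s+1}/(s(s+1))` -/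

section Integrand

variable (K : Type*) [Field K] [NumberField K]

/-- The Perron integrand of the Riesz mean of `Λ_K`:
`F_{K,x}(s) = (1/(s−1) − ζ₁_K'/ζ₁_K(s)) · x^{s+1}/(s(s+1))` (`= (−ζ_K'/ζ_K)(s) x^{s+1}/(s(s+1))`),
meromorphic on `Re s > 1/2` under ERH with a single simple pole at `s = 1`. [folklore] -/
def perronIntegrand (x : ℝ) (s : ℂ) : ℂ :=
  (1 / (s - 1) - logDeriv (dedekindZeta₁ K) s) * ((x : ℂ) ^ (s + 1) / (s * (s + 1)))

variable {K}

/-- **`1/(s−1) − ζ₁_K'/ζ₁_K(s) = −ζ_K'/ζ_K(s) = ∑ Λ_K(n) n^{-s}`** for `Re s > 1`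
(`ζ₁_K = (s−1)ζ_K` there and `−ζ_K'/ζ_K = L(Λ_K)`, `neg_logDeriv_dedekindZeta_eq`).
[cite: LandauMathAnn1903, §11 p. 668] -/
theorem one_div_sub_logDeriv_dedekindZeta₁_eq {s : ℂ} (hs : 1 < s.re) :
    1 / (s - 1) - logDeriv (dedekindZeta₁ K) s =
      LSeries (fun n ↦ (NumberField.vonMangoldtIdeal K n : ℂ)) s := by
  have hs1 : s - 1 ≠ 0 := NumberField.sub_one_ne_zero_of_one_lt_re hs
  have hopen : IsOpen {z : ℂ | 1 < z.re} := continuous_re.isOpen_preimage _ isOpen_Ioi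
  have hev : dedekindZeta₁ K =ᶠ[𝓝 s] fun z ↦ (z - 1) * _root_.NumberField.dedekindZeta K z :=
    eventually_of_mem (hopen.mem_nhds hs) fun z hz ↦ dedekindZeta₁_apply_eq_mul hz
  have hζ := NumberField.dedekindZeta_ne_zero_of_one_lt_re K hs
  have hd : DifferentiableAt ℂ (_root_.NumberField.dedekindZeta K) s :=
    (NumberField.analyticOnNhd_dedekindZeta K s hs).differentiableAt
  have h1 : logDeriv (dedekindZeta₁ K) s = logDeriv (fun z ↦ (z - 1) * _root_.NumberField.dedekindZeta K z) s := by
    rw [logDeriv_apply, logDeriv_apply, hev.deriv_eq, hev.self_of_nhds]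
  have h2 : logDeriv (fun z : ℂ ↦ z - 1) s = 1 / (s - 1) := by
    rw [logDeriv_apply, deriv_sub_const, deriv_id'']
  rw [h1, logDeriv_mul (f := fun z : ℂ ↦ z - 1) (g := _root_.NumberField.dedekindZeta K) s hs1 hζ
    (differentiableAt_fun_id.sub_const 1) hd, h2, logDeriv_apply,
    ← NumberField.neg_logDeriv_dedekindZeta_eq K hs]
  ring

/-- On `Re s > 1` the Perron integrand is the Riesz-mean integrand of `Λ_K`:
`F_{K,x}(s) = x^{1+s} L(Λ_K, s)/(s(s+1))`. [folklore] -/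
theorem perronIntegrand_eq_of_one_lt_re (x : ℝ) {s : ℂ} (hs : 1 < s.re) :
    perronIntegrand K x s = (x : ℂ) ^ (1 + s) *
      LSeries (fun n ↦ (NumberField.vonMangoldtIdeal K n : ℂ)) s * (1 / (s * (s + 1))) := by
  rw [perronIntegrand, one_div_sub_logDeriv_dedekindZeta₁_eq hs, add_comm s 1]
  ring

/-- Under ERH, `ζ₁_K'/ζ₁_K` is differentiable at every `s` with `Re s > 1/2`. [folklore] -/
theorem differentiableAt_logDeriv_dedekindZeta₁ (hERH : NumberField.ExtendedRiemannHypothesis K)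
    {s : ℂ} (hs : 1 / 2 < s.re) : DifferentiableAt ℂ (logDeriv (dedekindZeta₁ K)) s := by
  have h0 := dedekindZeta₁_ne_zero_of_erh hERH hs
  have hf : AnalyticAt ℂ (dedekindZeta₁ K) s := (dedekindZeta₁_differentiable K).analyticAt s
  have : logDeriv (dedekindZeta₁ K) = fun z ↦ deriv (dedekindZeta₁ K) z / dedekindZeta₁ K z := by
    ext z; rw [logDeriv_apply]
  rw [this]
  exact hf.deriv.differentiableAt.div hf.differentiableAt h0

/-- Under ERH, `F_{K,x}` is differentiable on `{Re s > 1/2} ∖ {1}` (for `x > 0`). [folklore] -/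
theorem differentiableOn_perronIntegrand (hERH : NumberField.ExtendedRiemannHypothesis K)
    {x : ℝ} (hx : 0 < x) :
    DifferentiableOn ℂ (perronIntegrand K x) ({s : ℂ | 1 / 2 < s.re} \ ({1} : Finset ℂ)) := by
  intro s hs
  rw [Finset.coe_singleton, Set.mem_sdiff, mem_setOf_eq, mem_singleton_iff] at hs
  obtain ⟨hs, hs1⟩ := hs
  have hx0 : (x : ℂ) ≠ 0 := ofReal_ne_zero.mpr hx.ne'
  have hs0 : s ≠ 0 := fun h ↦ by rw [h, zero_re] at hs; norm_num at hs
  have hs1' : s + 1 ≠ 0 := fun h ↦ by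
    have := congrArg re h; rw [add_re, one_re, zero_re] at this; linarith
  refine DifferentiableAt.differentiableWithinAt ?_
  unfold perronIntegrand
  refine DifferentiableAt.mul (DifferentiableAt.sub ?_ (differentiableAt_logDeriv_dedekindZeta₁ hERH hs)) ?_
  · exact (differentiableAt_const 1).div (differentiableAt_id.sub_const 1) (sub_ne_zero.mpr hs1)
  · refine DifferentiableAt.div ?_ (differentiableAt_id.mul (differentiableAt_id.add_const 1))
      (mul_ne_zero hs0 hs1')
    exact (differentiableAt_id.add_const 1).const_cpow (Or.inl hx0)

/-- Under ERH, `F_{K,x}` is continuous along any vertical line `Re s = σ` with `σ > 1/2`,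
`σ ≠ 1`. [folklore] -/
theorem continuous_perronIntegrand_vertical (hERH : NumberField.ExtendedRiemannHypothesis K)
    {x : ℝ} (hx : 0 < x) {σ : ℝ} (hσ : 1 / 2 < σ) (hσ1 : σ ≠ 1) :
    Continuous fun y : ℝ ↦ perronIntegrand K x (σ + y * I) := by
  have h := (differentiableOn_perronIntegrand hERH hx).continuousOn.comp_continuous
    (f := fun y : ℝ ↦ (σ : ℂ) + y * I) (by fun_prop) (fun y ↦ ?_)
  · exact h
  · rw [Finset.coe_singleton, Set.mem_sdiff, mem_setOf_eq, mem_singleton_iff]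
    refine ⟨by simpa using hσ, fun h ↦ hσ1 ?_⟩
    have := congrArg re h
    simpa using this

/-- The simple pole of `F_{K,x}` at `s = 1`, residue `x²/2`: near `1`,
`F_{K,x}(z) = φ(z)/(z − 1)` with `φ(z) = (1 − (z−1) ζ₁'/ζ₁(z)) x^{z+1}/(z(z+1))` holomorphic,
`φ(1) = x²/2`. [folklore] -/
theorem perronIntegrand_pole (hERH : NumberField.ExtendedRiemannHypothesis K) {x : ℝ} (hx : 0 < x) :
    ∃ φ : ℂ → ℂ, ∃ V ∈ 𝓝 (1 : ℂ), DifferentiableOn ℂ φ V ∧ φ 1 = (x : ℂ) ^ 2 / 2 ∧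
      ∀ z ∈ V, z ≠ 1 → perronIntegrand K x z = φ z / (z - 1) := by
  have hx0 : (x : ℂ) ≠ 0 := ofReal_ne_zero.mpr hx.ne'
  set V : Set ℂ := {z : ℂ | 1 / 2 < z.re} with hV
  have hVo : IsOpen V := continuous_re.isOpen_preimage _ isOpen_Ioi
  have h1V : (1 : ℂ) ∈ V := by rw [hV]; show (1 : ℝ) / 2 < (1 : ℂ).re; norm_num
  refine ⟨fun z ↦ (1 - (z - 1) * logDeriv (dedekindZeta₁ K) z) * ((x : ℂ) ^ (z + 1) / (z * (z + 1))),
    V, hVo.mem_nhds h1V, ?_, ?_, ?_⟩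
  · intro z hz
    have hz : 1 / 2 < z.re := hz
    have hz0 : z ≠ 0 := fun h ↦ by rw [h, zero_re] at hz; norm_num at hz
    have hz1' : z + 1 ≠ 0 := fun h ↦ by
      have := congrArg re h; rw [add_re, one_re, zero_re] at this; linarith
    refine DifferentiableAt.differentiableWithinAt ?_
    refine DifferentiableAt.mul (DifferentiableAt.sub (differentiableAt_const 1)
      ((differentiableAt_id.sub_const 1).mul (differentiableAt_logDeriv_dedekindZeta₁ hERH hz))) ?_
    refine DifferentiableAt.div ?_ (differentiableAt_id.mul (differentiableAt_id.add_const 1))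
      (mul_ne_zero hz0 hz1')
    exact (differentiableAt_id.add_const 1).const_cpow (Or.inl hx0)
  · simp only [sub_self, zero_mul, sub_zero, one_mul]
    rw [show (1 : ℂ) + 1 = (2 : ℕ) by norm_num, cpow_natCast]
    ring
  · intro z _ hz1
    have hz1' : z - 1 ≠ 0 := sub_ne_zero.mpr hz1
    unfold perronIntegrand
    field_simp

end Integrand

/-! ### Bounds for the integrand on the two lines -/

section Bounds

variable {K : Type*} [Field K] [NumberField K]

/-- `‖x^{w}‖ = x^{Re w}` for `x > 0`, and hence `‖x^{s+1}‖ = x^{σ+1}` on `Re s = σ`. [folklore] -/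
theorem norm_cpow_vertical {x : ℝ} (hx : 0 < x) (σ y : ℝ) :
    ‖(x : ℂ) ^ ((σ : ℂ) + y * I + 1)‖ = x ^ (σ + 1) := by
  rw [norm_cpow_eq_rpow_re_of_pos hx]
  simp

/-- On the right line `Re s = 2`: `‖F_{K,x}(2 + iy)‖ ≤ ℓ₂ x³/(4 + y²)` with
`ℓ₂ = ∑ Λ_K(n) n^{-2}` (absolute convergence). [folklore] -/
theorem norm_perronIntegrand_two_le {x : ℝ} (hx : 0 < x) (y : ℝ) :
    ‖perronIntegrand K x (2 + y * I)‖ ≤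
      (LSeries (fun n ↦ (NumberField.vonMangoldtIdeal K n : ℂ)) 2).re * x ^ (3 : ℝ) *
        (1 / (2 ^ 2 + y ^ 2)) := by
  have h2 : 1 < ((2 : ℂ) + y * I).re := by simp
  rw [perronIntegrand_eq_of_one_lt_re x h2, norm_mul, norm_mul]
  have hL := ClassicalZFRData.norm_LSeries_le_re (Λ := NumberField.vonMangoldtIdeal K)
    (NumberField.vonMangoldtIdeal_nonneg K) (fun s hs ↦ NumberField.LSeriesSummable_vonMangoldtIdeal K hs)
    (s := 2 + y * I) (σ' := 2) (by norm_num) (by simp)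
  have hL0 := (ClassicalZFRData.LSeries_ofReal_eq (Λ := NumberField.vonMangoldtIdeal K)
    (NumberField.vonMangoldtIdeal_nonneg K) 2).2
  push_cast at hL hL0
  have hK := norm_kernel_le (σ := 2) two_pos y
  have hxpow : ‖(x : ℂ) ^ (1 + (2 + (y : ℂ) * I))‖ = x ^ (3 : ℝ) := by
    rw [norm_cpow_eq_rpow_re_of_pos hx]; simp; norm_num
  rw [hxpow]
  have hx3 : 0 ≤ x ^ (3 : ℝ) := Real.rpow_nonneg hx.le _
  push_cast at hK ⊢
  calc x ^ (3 : ℝ) * ‖LSeries (fun n ↦ (NumberField.vonMangoldtIdeal K n : ℂ)) (2 + y * I)‖ *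
        ‖1 / ((2 + (y : ℂ) * I) * (2 + (y : ℂ) * I + 1))‖
      ≤ x ^ (3 : ℝ) * (LSeries (fun n ↦ (NumberField.vonMangoldtIdeal K n : ℂ)) 2).re *
          (1 / (2 ^ 2 + y ^ 2)) :=
        mul_le_mul (mul_le_mul_of_nonneg_left hL hx3) hK (norm_nonneg _) (mul_nonneg hx3 hL0)
    _ = _ := by ring

/-- On the left line `Re s = σ₁ = 1/2 + η`, under ERH (`0 < η ≤ 1/4`):
`‖F_{K,x}(σ₁ + iy)‖ ≤ (4 + 3024 M_K(y)/η) x^{σ₁+1}/(1/4 + y²)`. [folklore] -/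
theorem norm_perronIntegrand_left_le (hERH : NumberField.ExtendedRiemannHypothesis K) {x : ℝ}
    (hx : 0 < x) {η : ℝ} (hη0 : 0 < η) (hη : η ≤ 1 / 4) (y : ℝ) :
    ‖perronIntegrand K x ((1 / 2 + η : ℝ) + y * I)‖ ≤
      (4 + 3024 * discBound K y / η) * x ^ (1 / 2 + η + 1) * (1 / (1 / 4 + y ^ 2)) := by
  set σ₁ : ℝ := 1 / 2 + η with hσ₁
  set s : ℂ := (σ₁ : ℂ) + y * I with hs
  have hsre : s.re = σ₁ := by simp [hs]
  have hsim : s.im = y := by simp [hs]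
  have hσ₁0 : 0 < σ₁ := by rw [hσ₁]; linarith
  unfold perronIntegrand
  rw [norm_mul, norm_div]
  -- the three factors
  have h1 : ‖1 / (s - 1) - logDeriv (dedekindZeta₁ K) s‖ ≤ 4 + 3024 * discBound K y / η := by
    refine (norm_sub_le _ _).trans (add_le_add ?_ ?_)
    · rw [norm_div, norm_one]
      have hre : |(s - 1).re| = 1 - σ₁ := by
        rw [sub_re, one_re, hsre, abs_of_nonpos (by rw [hσ₁]; linarith)]; ring
      have h14 : 1 / 4 ≤ ‖s - 1‖ := by
        calc (1 : ℝ) / 4 ≤ 1 - σ₁ := by rw [hσ₁]; linarith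
          _ = |(s - 1).re| := hre.symm
          _ ≤ ‖s - 1‖ := abs_re_le_norm _
      rw [div_le_iff₀ (lt_of_lt_of_le (by norm_num) h14)]
      linarith
    · have := norm_logDeriv_dedekindZeta₁_le_of_erh' K hERH hη0 hη (s := s)
        (by rw [hsre]) (by rw [hsre, hσ₁]; linarith)
      rwa [hsim] at this
  have h2 : ‖(x : ℂ) ^ (s + 1)‖ = x ^ (σ₁ + 1) := by rw [hs]; exact norm_cpow_vertical hx σ₁ y
  have h3 : ‖(1 : ℂ)‖ / ‖s * (s + 1)‖ ≤ 1 / (1 / 4 + y ^ 2) := by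
    have := norm_kernel_le hσ₁0 y
    rw [norm_div, norm_one] at this
    rw [norm_one, hs]
    refine this.trans (one_div_le_one_div_of_le (by positivity) ?_)
    have : 1 / 4 ≤ σ₁ ^ 2 := by rw [hσ₁]; nlinarith
    linarith
  have hM : 0 ≤ 4 + 3024 * discBound K y / η := by
    have := discBound_nonneg K y; positivity
  calc ‖1 / (s - 1) - logDeriv (dedekindZeta₁ K) s‖ * (‖(x : ℂ) ^ (s + 1)‖ / ‖s * (s + 1)‖)
      = ‖1 / (s - 1) - logDeriv (dedekindZeta₁ K) s‖ * ‖(x : ℂ) ^ (s + 1)‖ *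
          (‖(1 : ℂ)‖ / ‖s * (s + 1)‖) := by rw [norm_one]; ring
    _ ≤ (4 + 3024 * discBound K y / η) * x ^ (σ₁ + 1) * (1 / (1 / 4 + y ^ 2)) := by
        rw [h2]; gcongr

/-- Decay on horizontal segments: under ERH, for `1 ≤ x`, `0 < η ≤ 1/4`, `|T| ≥ 1` and
`1/2 + η ≤ σ ≤ 2`, `‖F_{K,x}(σ + iT)‖ ≤ (1 + 3024 M_K(T)/η) x³/T²`. [folklore] -/
theorem norm_perronIntegrand_horizontal_le (hERH : NumberField.ExtendedRiemannHypothesis K) {x : ℝ}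
    (hx : 1 ≤ x) {η : ℝ} (hη0 : 0 < η) (hη : η ≤ 1 / 4) {T : ℝ} (hT : 1 ≤ |T|) {σ : ℝ}
    (hσ₁ : 1 / 2 + η ≤ σ) (hσ₂ : σ ≤ 2) :
    ‖perronIntegrand K x (σ + T * I)‖ ≤ (1 + 3024 * discBound K T / η) * x ^ (3 : ℝ) / T ^ 2 := by
  set s : ℂ := (σ : ℂ) + T * I with hs
  have hsre : s.re = σ := by simp [hs]
  have hsim : s.im = T := by simp [hs]
  have hx0 : 0 < x := by linarith
  have hT0 : 0 < |T| := by linarith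
  unfold perronIntegrand
  rw [norm_mul, norm_div]
  have h1 : ‖1 / (s - 1) - logDeriv (dedekindZeta₁ K) s‖ ≤ 1 + 3024 * discBound K T / η := by
    refine (norm_sub_le _ _).trans (add_le_add ?_ ?_)
    · rw [norm_div, norm_one]
      have hT' : |T| ≤ ‖s - 1‖ := by
        have := abs_im_le_norm (s - 1); rwa [sub_im, one_im, hsim, sub_zero] at this
      rw [div_le_iff₀ (hT0.trans_le hT'), one_mul]
      exact hT.trans hT'
    · have := norm_logDeriv_dedekindZeta₁_le_of_erh' K hERH hη0 hη (s := s) (by rw [hsre]; exact hσ₁)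
        (by rw [hsre]; exact hσ₂)
      rwa [hsim] at this
  have h2 : ‖(x : ℂ) ^ (s + 1)‖ ≤ x ^ (3 : ℝ) := by
    rw [hs, norm_cpow_vertical hx0 σ T]
    exact Real.rpow_le_rpow_of_exponent_le hx (by linarith)
  have h3 : ‖(1 : ℂ)‖ / ‖s * (s + 1)‖ ≤ 1 / T ^ 2 := by
    rw [norm_one, norm_mul]
    have ha : |T| ≤ ‖s‖ := by have := abs_im_le_norm s; rwa [hsim] at this
    have hb : |T| ≤ ‖s + 1‖ := by
      have := abs_im_le_norm (s + 1); rwa [add_im, one_im, hsim, add_zero] at this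
    have hT2 : T ^ 2 = |T| * |T| := by rw [← sq, sq_abs]
    rw [hT2]
    exact one_div_le_one_div_of_le (by positivity) (mul_le_mul ha hb hT0.le (norm_nonneg _))
  have hM : 0 ≤ 1 + 3024 * discBound K T / η := by
    have := discBound_nonneg K T; positivity
  calc ‖1 / (s - 1) - logDeriv (dedekindZeta₁ K) s‖ * (‖(x : ℂ) ^ (s + 1)‖ / ‖s * (s + 1)‖)
      = ‖1 / (s - 1) - logDeriv (dedekindZeta₁ K) s‖ * ‖(x : ℂ) ^ (s + 1)‖ *
          (‖(1 : ℂ)‖ / ‖s * (s + 1)‖) := by rw [norm_one]; ring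
    _ ≤ (1 + 3024 * discBound K T / η) * x ^ (3 : ℝ) * (1 / T ^ 2) := by gcongr
    _ = _ := by ring

end Bounds

/-! ### Integrability on the two lines and decay on horizontals -/

section Lines

variable {K : Type*} [Field K] [NumberField K]

/-- `t ↦ 1/(1/4 + t²)` is integrable. [folklore] -/
theorem integrable_inv_quarter_add_sq : Integrable fun t : ℝ ↦ 1 / (1 / 4 + t ^ 2) := by
  have h := integrable_inv_sq_add_sq (σ := 1 / 2) (by norm_num)
  refine h.congr (Eventually.of_forall fun t ↦ ?_)
  norm_num

/-- Under ERH, `F_{K,x}` is integrable along `Re s = 2`. [folklore] -/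
theorem integrable_perronIntegrand_two (hERH : NumberField.ExtendedRiemannHypothesis K) {x : ℝ}
    (hx : 0 < x) : Integrable fun y : ℝ ↦ perronIntegrand K x ((2 : ℝ) + y * I) := by
  have hcont : Continuous fun y : ℝ ↦ perronIntegrand K x ((2 : ℝ) + y * I) :=
    continuous_perronIntegrand_vertical hERH hx (σ := 2) (by norm_num) (by norm_num)
  set C : ℝ := (LSeries (fun n ↦ (NumberField.vonMangoldtIdeal K n : ℂ)) 2).re * x ^ (3 : ℝ) with hC
  have hint : Integrable fun y : ℝ ↦ C * (1 / (2 ^ 2 + y ^ 2)) :=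
    (integrable_inv_sq_add_sq (σ := 2) two_pos).const_mul C
  refine hint.mono' hcont.aestronglyMeasurable (Eventually.of_forall fun y ↦ ?_)
  have h := norm_perronIntegrand_two_le (K := K) hx y
  have hcast : ((2 : ℝ) : ℂ) + (y : ℂ) * I = 2 + (y : ℂ) * I := by push_cast; ring
  rw [hcast, hC]
  exact h

/-- Under ERH, `F_{K,x}` is integrable along `Re s = 1/2 + η` (`0 < η ≤ 1/4`), dominated by
`(4 + 3024 M_K(y)/η) x^{3/2+η}/(1/4 + y²)`. [folklore] -/
theorem integrable_perronIntegrand_left (hERH : NumberField.ExtendedRiemannHypothesis K) {x : ℝ}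
    (hx : 0 < x) {η : ℝ} (hη0 : 0 < η) (hη : η ≤ 1 / 4) :
    Integrable fun y : ℝ ↦ perronIntegrand K x ((1 / 2 + η : ℝ) + y * I) := by
  have hcont : Continuous fun y : ℝ ↦ perronIntegrand K x ((1 / 2 + η : ℝ) + y * I) :=
    continuous_perronIntegrand_vertical hERH hx (σ := 1 / 2 + η) (by linarith) (by linarith)
  set A : ℝ := Real.log ((discr K).natAbs : ℝ) + 3 * Module.finrank ℚ K with hA
  set B : ℝ := Module.finrank ℚ K + 1 with hB
  set P : ℝ := x ^ (1 / 2 + η + 1) with hP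
  set c₁ : ℝ := (4 + 3024 * A / η) * P with hc₁
  set c₂ : ℝ := 3024 * B / η * P with hc₂
  have hint : Integrable fun y : ℝ ↦ c₁ * (1 / (1 / 4 + y ^ 2)) +
      c₂ * (Real.log (|y| + 7) / (1 / 4 + y ^ 2)) :=
    (integrable_inv_quarter_add_sq.const_mul c₁).add (integrable_log_div_sq.const_mul c₂)
  refine hint.mono' hcont.aestronglyMeasurable (Eventually.of_forall fun y ↦ ?_)
  refine (norm_perronIntegrand_left_le hERH hx hη0 hη y).trans (le_of_eq ?_)
  rw [discBound, ← hA, hc₁, hc₂, hB]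
  ring

/-- `M_K(T) ≤ (log|d_K| + 3n_K + 8(n_K+1)) |T|` for `|T| ≥ 1` (`log(|T|+7) ≤ |T| + 6 ≤ 8|T|`).
[folklore] -/
theorem discBound_le_mul_abs (K : Type*) [Field K] [NumberField K] {T : ℝ} (hT : 1 ≤ |T|) :
    discBound K T ≤ (Real.log ((discr K).natAbs : ℝ) + 3 * Module.finrank ℚ K +
      8 * (Module.finrank ℚ K + 1)) * |T| := by
  unfold discBound
  have hlog : Real.log (|T| + 7) ≤ 8 * |T| := by
    have := Real.log_le_sub_one_of_pos (x := |T| + 7) (by linarith)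
    linarith
  have hA : 0 ≤ Real.log ((discr K).natAbs : ℝ) := Real.log_natCast_nonneg _
  have hn : (0 : ℝ) ≤ Module.finrank ℚ K := Nat.cast_nonneg _
  have hlog0 : 0 ≤ Real.log (|T| + 7) := zero_le_one.trans (one_le_log_abs_add_seven T)
  nlinarith

/-- Under ERH, for `x ≥ 1` and `0 < η ≤ 1/4`: `sup_{1/2+η ≤ σ ≤ 2} ‖F_{K,x}(σ + iT)‖ → 0` as
`|T| → ∞` (quantitatively `≪_{K,x,η} 1/|T|`). [folklore] -/
theorem perronIntegrand_decay (hERH : NumberField.ExtendedRiemannHypothesis K) {x : ℝ} (hx : 1 ≤ x)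
    {η : ℝ} (hη0 : 0 < η) (hη : η ≤ 1 / 4) :
    ∀ ε : ℝ, 0 < ε → ∃ T₀ : ℝ, ∀ T : ℝ, T₀ ≤ |T| → ∀ σ ∈ Icc (1 / 2 + η) 2,
      ‖perronIntegrand K x (σ + T * I)‖ ≤ ε := by
  intro ε hε
  set D : ℝ := Real.log ((discr K).natAbs : ℝ) + 3 * Module.finrank ℚ K +
    8 * (Module.finrank ℚ K + 1) with hD
  have hD0 : 0 ≤ D := by
    have : 0 ≤ Real.log ((discr K).natAbs : ℝ) := Real.log_natCast_nonneg _
    rw [hD]; positivity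
  set C₂ : ℝ := (1 + 3024 * D / η) * x ^ (3 : ℝ) with hC₂
  have hC₂0 : 0 ≤ C₂ := by rw [hC₂]; positivity
  refine ⟨max 1 (C₂ / ε), fun T hT σ hσ ↦ ?_⟩
  have hT1 : 1 ≤ |T| := le_of_max_le_left hT
  have hT2 : C₂ / ε ≤ |T| := le_of_max_le_right hT
  have hT0 : 0 < |T| := by linarith
  have h := norm_perronIntegrand_horizontal_le hERH hx hη0 hη hT1 hσ.1 hσ.2
  have hM := discBound_le_mul_abs K hT1
  rw [← hD] at hM
  have hx3 : 0 ≤ x ^ (3 : ℝ) := Real.rpow_nonneg (by linarith) _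
  have hstep : (1 + 3024 * discBound K T / η) * x ^ (3 : ℝ) / T ^ 2 ≤ C₂ / |T| := by
    have h1 : 1 + 3024 * discBound K T / η ≤ (1 + 3024 * D / η) * |T| := by
      rw [add_mul, one_mul]
      refine add_le_add hT1 ?_
      rw [div_mul_eq_mul_div]
      exact div_le_div_of_nonneg_right (by nlinarith) hη0.le
    have hT2' : T ^ 2 = |T| * |T| := by rw [← sq, sq_abs]
    rw [hT2', div_le_div_iff₀ (by positivity) hT0, hC₂]
    have := mul_le_mul_of_nonneg_right h1 hx3
    nlinarith
  refine h.trans (hstep.trans ?_)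
  rw [div_le_iff₀ hT0]
  rw [div_le_iff₀ hε] at hT2
  nlinarith

end Lines

/-! ### The identity and the lower bound for the Riesz mean -/

section Main

variable {K : Type*} [Field K] [NumberField K]

/-- **The shifted Perron formula for `Λ_K` under ERH**: for `x ≥ 1` and `0 < η ≤ 1/4`,
`∑_{n ≤ x} Λ_K(n)(x − n) = x²/2 + (1/2π) ∫ F_{K,x}(1/2 + η + iy) dy`
(Riesz mean at `Re s = 2`, then the residue theorem for the strip `1/2 + η ≤ Re s ≤ 2` with the
single simple pole at `s = 1`). [cite: LagariasOdlyzko1977, §7] -/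
theorem rieszMean_vonMangoldtIdeal_eq (hERH : NumberField.ExtendedRiemannHypothesis K) {x : ℝ}
    (hx : 1 ≤ x) {η : ℝ} (hη0 : 0 < η) (hη : η ≤ 1 / 4) :
    ((∑ n ∈ Finset.Ioc 0 ⌊x⌋₊, NumberField.vonMangoldtIdeal K n * (x - n) : ℝ) : ℂ) =
      (x : ℂ) ^ 2 / 2 + (1 / (2 * Real.pi) : ℂ) *
        ∫ y : ℝ, perronIntegrand K x ((1 / 2 + η : ℝ) + y * I) := by
  have hx0 : 0 < x := by linarith
  -- the Riesz mean on the line `Re s = 2`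
  have hR := rieszMean_eq_integral_LSeries (NumberField.vonMangoldtIdeal K)
    (NumberField.vonMangoldtIdeal_zero K) hx0 (σ := 2) two_pos
    (NumberField.LSeriesSummable_vonMangoldtIdeal K (by simp))
  have hF2 : ∀ t : ℝ, (x : ℂ) ^ (1 + (((2 : ℝ) : ℂ) + t * I)) *
      LSeries (fun n ↦ (NumberField.vonMangoldtIdeal K n : ℂ)) (((2 : ℝ) : ℂ) + t * I) *
        (1 / ((((2 : ℝ) : ℂ) + t * I) * (((2 : ℝ) : ℂ) + t * I + 1))) =
      perronIntegrand K x (((2 : ℝ) : ℂ) + t * I) := fun t ↦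
    (perronIntegrand_eq_of_one_lt_re x (by simp : 1 < ((((2 : ℝ) : ℂ) + t * I)).re)).symm
  rw [integral_congr_ae (Eventually.of_forall hF2)] at hR
  -- the residue theorem
  have hres := Literature.Analysis.Complex.integral_vertical_sub_eq_sum_of_simplePoles
    (F := perronIntegrand K x) (a := 1 / 2 + η) (b := 2) (by linarith) ({1} : Finset ℂ)
    (fun _ ↦ (x : ℂ) ^ 2 / 2) {s : ℂ | 1 / 2 < s.re}
    (continuous_re.isOpen_preimage _ isOpen_Ioi)
    (fun s hs ↦ by
      simp only [mem_preimage, mem_Icc] at hs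
      show 1 / 2 < s.re
      linarith [hs.1])
    (fun p hp ↦ by
      rw [Finset.mem_singleton] at hp
      rw [hp, one_re]
      constructor <;> linarith)
    (differentiableOn_perronIntegrand hERH hx0)
    (fun p hp ↦ by
      rw [Finset.mem_singleton] at hp
      rw [hp]
      exact perronIntegrand_pole hERH hx0)
    (integrable_perronIntegrand_left hERH hx0 hη0 hη)
    (integrable_perronIntegrand_two hERH hx0)
    (perronIntegrand_decay hERH hx hη0 hη)
  rw [Finset.sum_singleton] at hres
  -- combine
  rw [hR]
  have hπ : (2 * Real.pi : ℂ) ≠ 0 := by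
    exact_mod_cast (mul_ne_zero two_ne_zero Real.pi_ne_zero)
  have hsub : (∫ y : ℝ, perronIntegrand K x (((2 : ℝ) : ℂ) + y * I)) =
      2 * Real.pi * ((x : ℂ) ^ 2 / 2) + ∫ y : ℝ, perronIntegrand K x (((1 / 2 + η : ℝ) : ℂ) + y * I) := by
    rw [← hres]; ring
  rw [hsub, mul_add, ← mul_assoc, one_div_mul_cancel hπ, one_mul]

/-- `J₀ = ∫ dt/(1/4 + t²)` (`= 2π`; only finiteness and positivity are used). [folklore] -/
def kernelIntegral : ℝ := ∫ t : ℝ, 1 / (1 / 4 + t ^ 2)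

/-- `J₁ = ∫ log(|t| + 7) dt/(1/4 + t²)` (a finite absolute constant). [folklore] -/
def logKernelIntegral : ℝ := ∫ t : ℝ, Real.log (|t| + 7) / (1 / 4 + t ^ 2)

/-- `J₀ ≥ 0`. [folklore] -/
theorem kernelIntegral_nonneg : 0 ≤ kernelIntegral :=
  integral_nonneg fun t ↦ by positivity

/-- `J₁ ≥ 0`. [folklore] -/
theorem logKernelIntegral_nonneg : 0 ≤ logKernelIntegral :=
  integral_nonneg fun t ↦ div_nonneg (zero_le_one.trans (one_le_log_abs_add_seven t)) (by positivity)

/-- The absolute constant of the Riesz-mean bound: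
`C₁ = e · 3028 · 5 · (J₀ + J₁)/(2π)`. [folklore] -/
def grhRieszConst : ℝ := Real.exp 1 * 3028 * 5 * (kernelIntegral + logKernelIntegral) / (2 * Real.pi)

/-- `C₁ ≥ 0`. [folklore] -/
theorem grhRieszConst_nonneg : 0 ≤ grhRieszConst := by
  unfold grhRieszConst
  have := kernelIntegral_nonneg; have := logKernelIntegral_nonneg
  positivity

/-- **Lower bound for the Riesz mean of `Λ_K` under ERH**: for `x ≥ e⁴`,
`∑_{n ≤ x} Λ_K(n)(x − n) ≥ x²/2 − C₁ x^{3/2} log x (log|d_K| + n_K)` with the absolute constant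
`C₁ = grhRieszConst` (take `η = 1/log x` in `rieszMean_vonMangoldtIdeal_eq` and bound the shifted
integral by `norm_perronIntegrand_left_le`). [cite: LagariasOdlyzko1977, Thm. 1.1] -/
theorem rieszMean_vonMangoldtIdeal_ge (hERH : NumberField.ExtendedRiemannHypothesis K) {x : ℝ}
    (hx : Real.exp 4 ≤ x) :
    x ^ 2 / 2 - grhRieszConst * x ^ (3 / 2 : ℝ) * Real.log x *
        (Real.log ((discr K).natAbs : ℝ) + Module.finrank ℚ K) ≤
      ∑ n ∈ Finset.Ioc 0 ⌊x⌋₊, NumberField.vonMangoldtIdeal K n * (x - n) := by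
  have he1 : 1 ≤ Real.exp 4 := Real.one_le_exp (by norm_num)
  have hx1 : 1 ≤ x := he1.trans hx
  have hx0 : 0 < x := by linarith
  set L : ℝ := Real.log x with hL
  have hL4 : 4 ≤ L := by
    rw [hL, ← Real.log_exp 4]; exact Real.log_le_log (Real.exp_pos 4) hx
  have hL0 : 0 < L := by linarith
  set η : ℝ := 1 / L with hη
  have hη0 : 0 < η := by positivity
  have hη4 : η ≤ 1 / 4 := by rw [hη]; exact one_div_le_one_div_of_le (by norm_num) hL4
  have hηL : 1 / η = L := by rw [hη, one_div_one_div]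
  -- the identity, real parts
  have hid := rieszMean_vonMangoldtIdeal_eq hERH hx1 hη0 hη4
  set S : ℝ := ∑ n ∈ Finset.Ioc 0 ⌊x⌋₊, NumberField.vonMangoldtIdeal K n * (x - n) with hS
  set Fint : ℂ := ∫ y : ℝ, perronIntegrand K x ((1 / 2 + η : ℝ) + y * I) with hFint
  have hre : S = x ^ 2 / 2 + 1 / (2 * Real.pi) * Fint.re := by
    have := congrArg re hid
    rw [ofReal_re] at this
    rw [this]
    simp only [add_re, mul_re]
    have h1 : ((x : ℂ) ^ 2 / 2).re = x ^ 2 / 2 := by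
      rw [← ofReal_pow, ← ofReal_ofNat, ← ofReal_div, ofReal_re]
    have h2 : ((1 / (2 * Real.pi) : ℂ)).re = 1 / (2 * Real.pi) := by
      rw [← ofReal_ofNat, ← ofReal_mul, ← ofReal_one, ← ofReal_div, ofReal_re]
    have h3 : ((1 / (2 * Real.pi) : ℂ)).im = 0 := by
      rw [← ofReal_ofNat, ← ofReal_mul, ← ofReal_one, ← ofReal_div, ofReal_im]
    rw [h1, h2, h3, zero_mul, sub_zero]
  -- the majorant and its integral
  set A : ℝ := Real.log ((discr K).natAbs : ℝ) + 3 * Module.finrank ℚ K with hA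
  set B : ℝ := Module.finrank ℚ K + 1 with hB
  set P : ℝ := x ^ (1 / 2 + η + 1) with hP
  set c₁ : ℝ := (4 + 3024 * A / η) * P with hc₁
  set c₂ : ℝ := 3024 * B / η * P with hc₂
  have hA0 : 0 ≤ A := by
    have : 0 ≤ Real.log ((discr K).natAbs : ℝ) := Real.log_natCast_nonneg _
    rw [hA]; positivity
  have hn1 : (1 : ℝ) ≤ Module.finrank ℚ K := by exact_mod_cast Module.finrank_pos (R := ℚ) (M := K)
  have hB1 : 1 ≤ B := by rw [hB]; linarith
  have hP0 : 0 < P := Real.rpow_pos_of_pos hx0 _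
  have hg : Integrable fun y : ℝ ↦ c₁ * (1 / (1 / 4 + y ^ 2)) +
      c₂ * (Real.log (|y| + 7) / (1 / 4 + y ^ 2)) :=
    (integrable_inv_quarter_add_sq.const_mul c₁).add (integrable_log_div_sq.const_mul c₂)
  have hbound : ∀ y : ℝ, ‖perronIntegrand K x ((1 / 2 + η : ℝ) + y * I)‖ ≤
      c₁ * (1 / (1 / 4 + y ^ 2)) + c₂ * (Real.log (|y| + 7) / (1 / 4 + y ^ 2)) := by
    intro y
    refine (norm_perronIntegrand_left_le hERH hx0 hη0 hη4 y).trans (le_of_eq ?_)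
    rw [discBound, ← hA, hc₁, hc₂, hB]
    ring
  have hnorm : ‖Fint‖ ≤ c₁ * kernelIntegral + c₂ * logKernelIntegral := by
    calc ‖Fint‖ ≤ ∫ y : ℝ, ‖perronIntegrand K x ((1 / 2 + η : ℝ) + y * I)‖ :=
          norm_integral_le_integral_norm _
      _ ≤ ∫ y : ℝ, (c₁ * (1 / (1 / 4 + y ^ 2)) + c₂ * (Real.log (|y| + 7) / (1 / 4 + y ^ 2))) :=
          integral_mono (integrable_perronIntegrand_left hERH hx0 hη0 hη4).norm hg hbound
      _ = c₁ * kernelIntegral + c₂ * logKernelIntegral := by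
          rw [integral_add (integrable_inv_quarter_add_sq.const_mul c₁)
            (integrable_log_div_sq.const_mul c₂), integral_const_mul, integral_const_mul]
          rfl
  -- `P = e x^{3/2}`
  have hPe : P = Real.exp 1 * x ^ (3 / 2 : ℝ) := by
    rw [hP, show (1 / 2 + η + 1 : ℝ) = 3 / 2 + η by ring, Real.rpow_add hx0, mul_comm]
    congr 1
    rw [Real.rpow_def_of_pos hx0, hη, ← hL]
    field_simp
  -- arithmetic
  have hJ0 := kernelIntegral_nonneg
  have hJ1 := logKernelIntegral_nonneg
  have hx32 : 0 ≤ x ^ (3 / 2 : ℝ) := Real.rpow_nonneg hx0.le _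
  have hAB : A + B ≤ 5 * (Real.log ((discr K).natAbs : ℝ) + Module.finrank ℚ K) := by
    rw [hA, hB]
    have : 0 ≤ Real.log ((discr K).natAbs : ℝ) := Real.log_natCast_nonneg _
    nlinarith
  have hBL : 4 ≤ B * L := by nlinarith
  have hAL : 0 ≤ A * L := mul_nonneg hA0 hL0.le
  have hc₁' : c₁ ≤ 3028 * (A + B) * L * P := by
    have h : 4 + 3024 * A / η ≤ 3028 * (A + B) * L := by
      rw [div_eq_mul_one_div, hηL]; nlinarith
    rw [hc₁]; exact mul_le_mul_of_nonneg_right h hP0.le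
  have hc₂' : c₂ ≤ 3028 * (A + B) * L * P := by
    have h : 3024 * B / η ≤ 3028 * (A + B) * L := by
      rw [div_eq_mul_one_div, hηL]; nlinarith
    rw [hc₂]; exact mul_le_mul_of_nonneg_right h hP0.le
  set J : ℝ := kernelIntegral + logKernelIntegral with hJ
  set D₀ : ℝ := Real.log ((discr K).natAbs : ℝ) + Module.finrank ℚ K with hD₀
  have hJ0' : 0 ≤ J := by rw [hJ]; positivity
  have hkey : 1 / (2 * Real.pi) * (c₁ * kernelIntegral + c₂ * logKernelIntegral) ≤
      grhRieszConst * x ^ (3 / 2 : ℝ) * L * D₀ := by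
    have hπ : 0 < 2 * Real.pi := by positivity
    have h1 : c₁ * kernelIntegral + c₂ * logKernelIntegral ≤ 3028 * (A + B) * L * P * J := by
      calc c₁ * kernelIntegral + c₂ * logKernelIntegral
          ≤ 3028 * (A + B) * L * P * kernelIntegral + 3028 * (A + B) * L * P * logKernelIntegral :=
            add_le_add (mul_le_mul_of_nonneg_right hc₁' hJ0) (mul_le_mul_of_nonneg_right hc₂' hJ1)
        _ = 3028 * (A + B) * L * P * J := by rw [hJ]; ring
    have h2 : 3028 * (A + B) * L * P * J ≤ 3028 * (5 * D₀) * L * P * J := by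
      have h0 : 0 ≤ 3028 * L * P * J := by positivity
      calc 3028 * (A + B) * L * P * J = 3028 * L * P * J * (A + B) := by ring
        _ ≤ 3028 * L * P * J * (5 * D₀) := mul_le_mul_of_nonneg_left hAB h0
        _ = 3028 * (5 * D₀) * L * P * J := by ring
    calc 1 / (2 * Real.pi) * (c₁ * kernelIntegral + c₂ * logKernelIntegral)
        ≤ 1 / (2 * Real.pi) * (3028 * (5 * D₀) * L * P * J) :=
          mul_le_mul_of_nonneg_left (h1.trans h2) (by positivity)
      _ = grhRieszConst * x ^ (3 / 2 : ℝ) * L * D₀ := by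
          rw [hPe, grhRieszConst, ← hJ]; ring
  -- conclude
  have hreF : -‖Fint‖ ≤ Fint.re := by
    have := abs_re_le_norm Fint
    have := neg_abs_le Fint.re
    linarith
  rw [hre]
  have hπ0 : 0 ≤ 1 / (2 * Real.pi) := by positivity
  have h3 : 1 / (2 * Real.pi) * (-‖Fint‖) ≤ 1 / (2 * Real.pi) * Fint.re :=
    mul_le_mul_of_nonneg_left hreF hπ0
  have h4 : 1 / (2 * Real.pi) * ‖Fint‖ ≤ grhRieszConst * x ^ (3 / 2 : ℝ) * L * D₀ :=
    (mul_le_mul_of_nonneg_left hnorm hπ0).trans hkey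
  linarith

/-- The absolute constant of the `ψ_K` bound: `C = max C₁ 30`. [folklore] -/
def grhPsiConst : ℝ := max grhRieszConst 30

/-- `C₁ ≤ C`. [folklore] -/
theorem grhRieszConst_le_grhPsiConst : grhRieszConst ≤ grhPsiConst := le_max_left _ _

/-- `30 ≤ C`. [folklore] -/
theorem thirty_le_grhPsiConst : 30 ≤ grhPsiConst := le_max_right _ _

/-- `C > 0`. [folklore] -/
theorem grhPsiConst_pos : 0 < grhPsiConst := lt_of_lt_of_le (by norm_num) thirty_le_grhPsiConst

/-- **Chebyshev lower bound for `ψ_K` under GRH, uniformly in the field** (a one-sided weak form of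
Lagarias–Odlyzko 1977, Thm. 1.1): if the Dedekind zeta function of the number field `K` satisfies
the Riemann hypothesis, then for every real `x ≥ 2`
`ψ_K(x) ≥ x/2 − C √x log x (log|d_K| + n_K)`, with the absolute constant `C = grhPsiConst`.
[cite: LagariasOdlyzko1977, Thm. 1.1] -/
theorem chebyshevPsiIdeal_ge_of_erh (hERH : NumberField.ExtendedRiemannHypothesis K) {x : ℝ}
    (hx : 2 ≤ x) :
    x / 2 - grhPsiConst * Real.sqrt x * Real.log x *
        (Real.log ((discr K).natAbs : ℝ) + Module.finrank ℚ K) ≤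
      NumberField.chebyshevPsiIdeal K x := by
  have hx0 : 0 < x := by linarith
  set D : ℝ := Real.log ((discr K).natAbs : ℝ) + Module.finrank ℚ K with hD
  have hn1 : (1 : ℝ) ≤ Module.finrank ℚ K := by exact_mod_cast Module.finrank_pos (R := ℚ) (M := K)
  have hD1 : 1 ≤ D := by
    have : 0 ≤ Real.log ((discr K).natAbs : ℝ) := Real.log_natCast_nonneg _
    rw [hD]; linarith
  have hψ0 : 0 ≤ NumberField.chebyshevPsiIdeal K x := NumberField.chebyshevPsiIdeal_nonneg K x
  have hsqrt2 : (7 : ℝ) / 5 ≤ Real.sqrt x := by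
    refine le_trans ?_ (Real.sqrt_le_sqrt hx)
    rw [Real.le_sqrt (by norm_num) (by norm_num)]; norm_num
  have hlog2 : (69 : ℝ) / 100 ≤ Real.log x := by
    refine le_trans ?_ (Real.log_le_log two_pos hx)
    have := Real.log_two_gt_d9; linarith
  rcases lt_or_ge x (Real.exp 4) with hsmall | hlarge
  · -- small `x`: the right side is `≥ 0`, the left side `≤ 0`
    have he : Real.exp 4 < 55 := by
      have h1 := Real.exp_one_lt_d9
      have h0 := Real.exp_pos 1
      have h4 : Real.exp 4 = (Real.exp 1 * Real.exp 1) * (Real.exp 1 * Real.exp 1) := by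
        rw [← Real.exp_add, ← Real.exp_add]; norm_num
      have h2 : Real.exp 1 * Real.exp 1 < 739 / 100 := by nlinarith
      rw [h4]
      calc (Real.exp 1 * Real.exp 1) * (Real.exp 1 * Real.exp 1) < 739 / 100 * (739 / 100) :=
            mul_lt_mul'' h2 h2 (by positivity) (by positivity)
        _ < 55 := by norm_num
    have hbig : (55 : ℝ) / 2 ≤ grhPsiConst * Real.sqrt x * Real.log x * D := by
      have h30 := thirty_le_grhPsiConst
      have : (55 : ℝ) / 2 ≤ 30 * (7 / 5) * (69 / 100) * 1 := by norm_num
      refine this.trans ?_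
      have hs0 : 0 ≤ Real.sqrt x := Real.sqrt_nonneg x
      gcongr
    linarith
  · -- large `x`: divide the Riesz-mean bound by `x`
    have hR := rieszMean_vonMangoldtIdeal_ge hERH hlarge
    have hle := rieszMean_le_mul_sum (NumberField.vonMangoldtIdeal K)
      (NumberField.vonMangoldtIdeal_nonneg K) hx0.le
    have hψ : NumberField.chebyshevPsiIdeal K x =
        ∑ n ∈ Finset.Icc 0 ⌊x⌋₊, NumberField.vonMangoldtIdeal K n := rfl
    rw [← hψ] at hle
    have hx32 : x ^ (3 / 2 : ℝ) = x * Real.sqrt x := by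
      rw [show (3 / 2 : ℝ) = 1 + 1 / 2 by norm_num, Real.rpow_add hx0, Real.rpow_one,
        Real.sqrt_eq_rpow]
    rw [hx32] at hR
    have hC := grhRieszConst_le_grhPsiConst
    have hC0 := grhRieszConst_nonneg
    have hprod : 0 ≤ Real.sqrt x * Real.log x * D := by
      have : 0 ≤ Real.log x := by linarith
      positivity
    -- `x ψ ≥ x²/2 − C₁ x √x log x D ≥ x (x/2 − C √x log x D)`
    have h1 : x * (x / 2 - grhPsiConst * Real.sqrt x * Real.log x * D) ≤
        x ^ 2 / 2 - grhRieszConst * (x * Real.sqrt x) * Real.log x * D := by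
      nlinarith [mul_le_mul_of_nonneg_right hC hprod]
    have h2 := h1.trans (hR.trans hle)
    exact le_of_mul_le_mul_left h2 hx0

end Main

end Literature.NumberTheory.LFunctions

end
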